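import Literature.AlgebraicGeometry.Modules.PushforwardBaseChangeIsoOfFibreVanishing
import Literature.AlgebraicGeometry.Modules.PushforwardBaseChangeRestrictBase
import HarnessLib

/-!
# The base-change morphism is an isomorphism from fibrewise `H¹`-vanishing — general locally noetherian base

[cite: MumfordAV1970, §5, Corollary 3 (p. 53)]
[cite: Hartshorne1977, III Theorem 12.11 (p. 290)]
[cite: Hartshorne1977, III Prop. 9.3]

The GENERAL-BASE head of the (h2) chain «cohomology and base change in degree `0`» for the base-change morphism
`β : b^*(p_* G) ⟶ (p_T)_*(pr^* G)` of ★ `Modules/PushforwardBaseChangeHom` (the `(hbc)` binder of ★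
`Morphisms/ContainmentRepOfPushforward`): `S` LOCALLY NOETHERIAN (not necessarily affine), `p : X → S` proper and flat, `G`
finite locally free on `X` with `p_* G` affine-localizing, and `Ext¹(𝒪_{X₀}, G|_{X₀}) = 0` on EVERY cartesian square
`X₀ = X ×_S Spec K` over a FIELD-valued point `Spec K → S`; then for ANY cartesian square `X_T = X ×_S T → T`, **`β` is an
isomorphism** (`isIso_pushforwardBaseChangeHom_of_forall_fieldPoint`; `…_of_compactSpace` discharges the affine-localizing
hypothesis when `S` is moreover quasi-compact, ★ `isAffineLocalizing_pushforward`).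

Proof: the question is local on `S` — ★ B-p04 (g19)'s `isIso_pushforwardBaseChangeHom_of_restrictBase` reduces to the
squares restricted over the affine opens `V ⊆ S` with base moved to `Spec Γ(S, V)` (`IsAffineOpen.isoSpec`), where ★
`exists_tensor_pushforward_linearEquiv_of_forall_fiber` (the affine-base chart theorem on Mathlib's canonical fibres)
applies: `Γ(S, V)` is noetherian, `p_V` proper flat, `G|_{p⁻¹V}` finite locally free, and the canonical fibre of `p_V` at a point
`y` of `Spec Γ(S, V)`, followed by `p⁻¹V ↪ X`, IS a fibre square of `p` over the field point `Spec κ(y) → S`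
(`isPullback_fiberι_comp_ι`: Mathlib `isPullback_morphismRestrict`, `IsPullback.of_iso`, `paste_horiz`), the vanishing
transported only along Mathlib `pullbackComp` (`subsingleton_ext_pullback_pullback`).  Interface note: the hypothesis is
asked on field-valued points (any field `K`, any square) rather than on the residue-field fibres `p.fiber s` only — this is
what the gluing consumes without transporting `Ext¹` along an isomorphism of fibre MODELS, and what the foreseeable
producers (abelian schemes, twists `𝓘(n)` on geometric fibres) prove uniformly in `K`.

Theorems only; no instance, notation, named fact.  Universe `Scheme.{0}`.  Cell `hodgecm-mathlib`, F-DAG (h2) → (h6-d), G10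
(B-p19 (g15); B-plan1 (g16) 07:05Z), over ★ (S3) of B-p04 (g19).  HC_CM is proved only modulo the 7 printed citations
until rung 0 closes — nothing here bears on a summit statement.

## References

* D. Mumford, *Abelian Varieties*, TIFR Studies in Mathematics 5 (1970), §5, Cor. 3 (p. 53). [MumfordAV1970]
* R. Hartshorne, *Algebraic Geometry*, GTM 52 (1977), III Thm. 12.11 (p. 290), III Prop. 9.3. [Hartshorne1977]
-/

noncomputable section

set_option backward.isDefEq.respectTransparency false

open CategoryTheory CategoryTheory.Limits CategoryTheory.Abelian Opposite TopologicalSpace AlgebraicGeometry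
open TensorProduct

namespace Literature.AlgebraicGeometry.Modules

open Literature.AlgebraicGeometry.Morphisms Literature.AlgebraicGeometry.HodgeTheory Literature.AlgebraicGeometry.Motives

section GeneralBase

/-- **A fibre square of `p` over a field-valued point of `S`, from an affine open `V ⊆ S` and a point `y` of `Spec Γ(S, V)`**:
Mathlib's fibre of `p_V ≫ (V ≅ Spec Γ(S, V)) : p⁻¹V → Spec Γ(S, V)` at `y`, followed by `p⁻¹V ↪ X`, is cartesian over
`Spec κ(y) → Spec Γ(S, V) ≅ V ↪ S` (Mathlib `isPullback_morphismRestrict` moved along `IsAffineOpen.isoSpec`, pasted to the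
canonical fibre square). [cite: Hartshorne1977, III Prop. 9.3 (proof)] -/
private theorem isPullback_fiberι_comp_ι {S X : Scheme.{0}} (p : X ⟶ S) (V : S.Opens) (hV : IsAffineOpen V)
    (y : Spec Γ(S, V)) :
    IsPullback ((p.resLE V (p ⁻¹ᵁ V) le_rfl ≫ hV.isoSpec.hom).fiberι y ≫ (p ⁻¹ᵁ V).ι)
      ((p.resLE V (p ⁻¹ᵁ V) le_rfl ≫ hV.isoSpec.hom).fiberToSpecResidueField y) p
      ((Spec Γ(S, V)).fromSpecResidueField y ≫ hV.isoSpec.inv ≫ V.ι) := by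
  have h₁ : IsPullback ((p.resLE V (p ⁻¹ᵁ V) le_rfl ≫ hV.isoSpec.hom).fiberι y)
      ((p.resLE V (p ⁻¹ᵁ V) le_rfl ≫ hV.isoSpec.hom).fiberToSpecResidueField y)
      (p.resLE V (p ⁻¹ᵁ V) le_rfl ≫ hV.isoSpec.hom) ((Spec Γ(S, V)).fromSpecResidueField y) :=
    IsPullback.of_hasPullback _ _
  have h₂ : IsPullback (p ⁻¹ᵁ V).ι (p.resLE V (p ⁻¹ᵁ V) le_rfl ≫ hV.isoSpec.hom) p (hV.isoSpec.inv ≫ V.ι) := by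
    have h := (isPullback_morphismRestrict p V).flip
    rw [← Scheme.Hom.resLE_eq_morphismRestrict] at h
    exact h.of_iso (Iso.refl _) (Iso.refl _) hV.isoSpec (Iso.refl _) (by simp) (by simp) (by simp) (by simp)
  exact h₁.paste_horiz h₂

/-- `Ext¹(𝒪, ·) = 0` passes from `(n ≫ m)^* G` to `n^* m^* G` (Mathlib `Scheme.Modules.pullbackComp`). [folklore] -/
private theorem subsingleton_ext_pullback_pullback {Y Z X : Scheme.{0}} (n : Y ⟶ Z) (m : Z ⟶ X) (G : X.Modules)
    (h : Subsingleton (Ext.{1} (unitModule Y) ((Scheme.Modules.pullback (n ≫ m)).obj G) 1)) :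
    Subsingleton (Ext.{1} (unitModule Y) ((Scheme.Modules.pullback n).obj ((Scheme.Modules.pullback m).obj G)) 1) := by
  let Φ : (Scheme.Modules.pullback n).obj ((Scheme.Modules.pullback m).obj G) ≅ (Scheme.Modules.pullback (n ≫ m)).obj G :=
    (Scheme.Modules.pullbackComp n m).app G
  refine ⟨fun x y => ?_⟩
  have key : ∀ z : Ext.{1} (unitModule Y) ((Scheme.Modules.pullback n).obj ((Scheme.Modules.pullback m).obj G)) 1,
      z = (z.comp (Ext.mk₀ Φ.hom) (add_zero 1)).comp (Ext.mk₀ Φ.inv) (add_zero 1) := fun z => by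
    rw [Ext.comp_assoc_of_second_deg_zero, Ext.mk₀_comp_mk₀, Iso.hom_inv_id, Ext.comp_mk₀_id]
  rw [key x, key y, Subsingleton.elim (x.comp _ _) (y.comp (Ext.mk₀ Φ.hom) (add_zero 1))]

/-- **THE BASE-CHANGE MORPHISM `β : b^*(p_* G) ⟶ (p_T)_*(pr^* G)` IS AN ISOMORPHISM — general locally noetherian base**
(Mumford §5 Cor. 3 / Hartshorne III 12.11 in degree `0`, glued over the base by Hartshorne III 9.3): `S` locally noetherian,
`p : X → S` proper and flat, `G` finite locally free on `X` with `p_* G` affine-localizing, and `Ext¹(𝒪_{X₀}, G|_{X₀}) = 0` for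
EVERY cartesian square `X₀ = X ×_S Spec K` over a FIELD-valued point `Spec K → S`; then for ANY cartesian square
`X_T = X ×_S T → T`, `β` is an isomorphism.  Proof: ★ `isIso_pushforwardBaseChangeHom_of_restrictBase` (the question is
local on `S`; base of the restricted square moved to `Spec Γ(S, V)`) + ★ `exists_tensor_pushforward_linearEquiv_of_forall_fiber`
on each restricted square, whose canonical fibres ARE fibre squares of `p` over field points (`isPullback_fiberι_comp_ι`).
[cite: MumfordAV1970, §5 Cor. 3 (p. 53)] [cite: Hartshorne1977, III Thm. 12.11 (p. 290)] [cite: Hartshorne1977, III Prop. 9.3 (proof)] -/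
theorem isIso_pushforwardBaseChangeHom_of_forall_fieldPoint {S X T XT : Scheme.{0}} [IsLocallyNoetherian S]
    {p : X ⟶ S} [IsProper p] [Flat p] (G : X.Modules) (hL : IsFiniteLocallyFree G)
    (hN : IsAffineLocalizing ((Scheme.Modules.pushforward p).obj G))
    (hvan : ∀ ⦃K : Type⦄ [Field K] ⦃X₀ : Scheme.{0}⦄ (i : X₀ ⟶ X) (f₀ : X₀ ⟶ Spec (CommRingCat.of K))
      (x : Spec (CommRingCat.of K) ⟶ S), IsPullback i f₀ p x →
        Subsingleton (Ext.{1} (unitModule X₀) ((Scheme.Modules.pullback i).obj G) 1))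
    {pr : XT ⟶ X} {pT : XT ⟶ T} {b : T ⟶ S} (H : IsPullback pr pT p b) :
    IsIso (pushforwardBaseChangeHom H.w G) := by
  refine isIso_pushforwardBaseChangeHom_of_restrictBase H.w G hN (fun V hV => hV.isoSpec.hom) fun V hV W' hW' => ?_
  haveI : IsAffine (V : Scheme.{0}) := hV
  haveI : IsNoetherianRing Γ(S, V) := IsLocallyNoetherian.component_noetherian ⟨V, hV⟩
  haveI : IsProper (p.resLE V (p ⁻¹ᵁ V) le_rfl ≫ hV.isoSpec.hom) := by
    rw [Scheme.Hom.resLE_eq_morphismRestrict]; infer_instance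
  have Hsq : IsPullback (pr.resLE (p ⁻¹ᵁ V) (pT ⁻¹ᵁ (b ⁻¹ᵁ V)) (preimage_preimage_eq_of_sq H.w V).ge)
      (pT.resLE (b ⁻¹ᵁ V) (pT ⁻¹ᵁ (b ⁻¹ᵁ V)) le_rfl) (p.resLE V (p ⁻¹ᵁ V) le_rfl ≫ hV.isoSpec.hom)
      (b.resLE V (b ⁻¹ᵁ V) le_rfl ≫ hV.isoSpec.hom) :=
    (isPullback_restrictBase V H).of_iso (Iso.refl _) (Iso.refl _) (Iso.refl _) hV.isoSpec
      (by simp) (by simp) (by simp) (by simp)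
  exact (exists_tensor_pushforward_linearEquiv_of_forall_fiber (A := Γ(S, V))
    (p.resLE V (p ⁻¹ᵁ V) le_rfl ≫ hV.isoSpec.hom) ((Scheme.Modules.pullback (p ⁻¹ᵁ V).ι).obj G) (hL.pullback _)
    (fun y => subsingleton_ext_pullback_pullback _ _ G (hvan _ _ _ (isPullback_fiberι_comp_ι p V hV y))) Hsq W' hW').1

/-- **The same over a (quasi-compact) NOETHERIAN base, with no affine-localizing hypothesis**: `X` is then a Noetherian scheme
and `p_* G` is affine-localizing by ★ `isAffineLocalizing_pushforward`.
[cite: MumfordAV1970, §5 Cor. 3 (p. 53)] [cite: Hartshorne1977, III Thm. 12.11 (p. 290)] [cite: Hartshorne1977, II Prop. 5.8 (c) (p. 115)] -/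
theorem isIso_pushforwardBaseChangeHom_of_forall_fieldPoint_of_compactSpace {S X T XT : Scheme.{0}} [IsLocallyNoetherian S]
    [CompactSpace S] {p : X ⟶ S} [IsProper p] [Flat p] (G : X.Modules) (hL : IsFiniteLocallyFree G)
    (hvan : ∀ ⦃K : Type⦄ [Field K] ⦃X₀ : Scheme.{0}⦄ (i : X₀ ⟶ X) (f₀ : X₀ ⟶ Spec (CommRingCat.of K))
      (x : Spec (CommRingCat.of K) ⟶ S), IsPullback i f₀ p x →
        Subsingleton (Ext.{1} (unitModule X₀) ((Scheme.Modules.pullback i).obj G) 1))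
    {pr : XT ⟶ X} {pT : XT ⟶ T} {b : T ⟶ S} (H : IsPullback pr pT p b) :
    IsIso (pushforwardBaseChangeHom H.w G) := by
  haveI := hL.isVectorBundle.1
  haveI : IsLocallyNoetherian X := LocallyOfFiniteType.isLocallyNoetherian p
  haveI : CompactSpace X := QuasiCompact.compactSpace_of_compactSpace p
  haveI : IsNoetherian X := { }
  exact isIso_pushforwardBaseChangeHom_of_forall_fieldPoint G hL
    (isAffineLocalizing_pushforward p (IsAffineLocalizing.of_isQuasicoherent G)) hvan H

end GeneralBase

end Literature.AlgebraicGeometry.Modules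

end
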